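import Summits.BirchSwinnertonDyer.BirchSwinnertonDyer.Theses.PrintX10b
import Summits.BirchSwinnertonDyer.BirchSwinnertonDyer.Theorems.PrintX10bHowardContainmentLightFrameX10bOfMuStabilized
import Summits.BirchSwinnertonDyer.BirchSwinnertonDyer.Theorems.PrintX10bSplitClosersStabilized
import Summits.BirchSwinnertonDyer.BirchSwinnertonDyer.Theorems.PrintX10bAssemblyLightTwinsX10b
import Summits.BirchSwinnertonDyer.BirchSwinnertonDyer.Theorems.PrintX10bTwoSidedLinkAnyClassNumberX10bPinnedOfPrint
import Summits.BirchSwinnertonDyer.BirchSwinnertonDyer.Theorems.PrintX10bAnalyticMuZeroX10b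
import HarnessLib

/-!
# Row-10 RESIDUAL CERTIFICATE (PrintX10b rev 35): the corner leaf `WAllCornerX10b` / `X10.BSDpOnClassX10b` from the
# route's cite-only PRINT binders ⊕ ONE beyond-print statement — the μ-inequality (row-10 letter
# `PrintX10bSharpMuStabilized.Stmt.muInequalityStabilized`, and the cell's ONE shared μ-item letter `MuPartStabilizedOfPrint`)

Cell `pub/bsd-print-x9`, LEAD `bsd-line-x10b-p2` (g3). THEOREMS ONLY (no definition, no named fact, no `sorry`);
`--supports stmt-BirchSwinnertonDyer-27275` (helper). Nothing is closed; no summit statement is proved by this seat; BSD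
is not proved by any of this.

WHAT. The route's deciding theorem `Theses.PrintX10b.closes` has eleven binders; three of them are CLOSED items with
kernel witnesses BY NAME (`AssemblyLightTwinsX10b` — `assemblyLightTwinsX10b_proof`, p622251;
`TwoSidedLinkAnyClassNumberX10bPinnedOfPrint` — `twoSidedLinkAnyClassNumberX10bPinnedOfPrint_holds`, p613989;
`AnalyticMuZeroX10b` — `AnalyticMuZeroX10b_of`), seven are cite-only print bundles / by-name print facts
(`MastellaZermanHowardDivisibility`, `CGLSHeegnerClassNonvanishing`, `CGSHowardDivisibilityPLocalized`,
`AnticyclotomicTowerSharp`, `PinnedTransferPrintFacts`, `HeegnerPrintFactsX10b`, `PrintFactsX10b`), and ONE is the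
deciding crux `HowardContainmentLightFrameX10bPinnedOfPrint` (stmt-27275), which the conditional closer
`howardContainmentLightFrameX10bPinnedOfPrint_of_muStabilized` (this seat, companion file) derives from its one residual
`Stmt.muInequalityStabilized` (the μ-inequality `μ(𝒳_tors) ≤ 2·μ(𝔖/Λκ_∞(C))` at `3 ∣ h_K`, BEYOND citable print per
REF-118; = the `(p)`-part, lower half, of CGLS22 Conj. 1 at any class number). Hence the two theorems below: the row-10
corner and the partition leaf GIVEN the seven print binders and the μ-inequality — the census «print ⊕ s_mu» of the row as
ONE kernel statement (REF-124's `residual_probe` with `hA3` replaced by the μ-residual).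

References: Castella–Grossi–Lee–Skinner, Invent. Math. 227 (2022), Conj. 1, Thm. 4.1.1; Castella–Grossi–Skinner, Math.
Ann. 393 (2025), Thm. 6.5.2; Mastella–Zerman, arXiv:2505.08710, Cor. 4.6; Yan–Zhu, J. Algebra 693 (2026), Thm. 5.7/5.9;
Jetchev–Skinner–Wan, Camb. J. Math. 5 (2017), Thm. 3.3.1.
-/

set_option linter.dupNamespace false
set_option autoImplicit false

noncomputable section

open Summit.BirchSwinnertonDyer.BirchSwinnertonDyer.Theses.PrintX10b
open Summit.BirchSwinnertonDyer.BirchSwinnertonDyer.Theorems.HeegnerMuPartStabilized (MuPartStabilizedOfPrint)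
open Summit.BirchSwinnertonDyer.BirchSwinnertonDyer.Theorems (PrintX10bSharpMuStabilized.Stmt.muInequalityStabilized
  PrintX10bSharpMuStabilized.howardContainmentLightFrameX10bPinnedOfPrint_of_muStabilized
  PrintX10bSharpMuStabilized.howardContainmentLightFrameX10bPinned_of_print_of_muStabilized
  PrintX10bSplitStabilized.howardContainmentLightFrameX10bPinnedOfPrint_of_common
  PrintX10bSplitStabilized.howardContainmentLightFrameX10bPinned_of_print_of_common)

namespace Summit.BirchSwinnertonDyer.BirchSwinnertonDyer.Theorems.PrintX10bResidualCertificate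

/-- **Row-10 corner `WAllCornerX10b` ⟸ seven cite-only print binders ⊕ the μ-inequality** (the route's `closes` with its
three closed doors supplied BY NAME and the deciding crux supplied by the conditional closer).
[cite: CastellaGrossiLeeSkinner2022, Conj. 1 (the μ-part) and Thm. 4.1.1] [cite: CastellaGrossiSkinner2025, Thm. 6.5.2]
[cite: MastellaZerman2026, Cor. 4.6] -/
theorem wallCornerX10b_of_muStabilized_of_printBinders (hμ : PrintX10bSharpMuStabilized.Stmt.muInequalityStabilized)
    (hMZ : MastellaZermanHowardDivisibility) (hNV : CGLSHeegnerClassNonvanishing)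
    (hCGS : CGSHowardDivisibilityPLocalized) (hTw : AnticyclotomicTowerSharp) (hPT : PinnedTransferPrintFacts)
    (hHP : HeegnerPrintFactsX10b) (hP : PrintFactsX10b) :
    Summit.BirchSwinnertonDyer.WAllCornerX10b :=
  -- buildfix (bf3-g30, class (i) drift): route PrintX10b's `closes` was re-keyed; the pre-edit body
  -- (`wallCornerX10b_of_bsdpOnClassX10b` ∘ light assembly, closed doors BY NAME) is inlined; statement unchanged.
  Summit.BirchSwinnertonDyer.Rank1Residual.WAll.wallCornerX10b_of_bsdpOnClassX10b
    (Summit.BirchSwinnertonDyer.BirchSwinnertonDyer.Theorems.PrintX10bAssemblyLightTwinsX10b.assemblyLightTwinsX10b_proof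
      (PrintX10bSharpMuStabilized.howardContainmentLightFrameX10bPinned_of_print_of_muStabilized hμ hMZ hNV hCGS hTw)
      (Summit.BirchSwinnertonDyer.BirchSwinnertonDyer.Theorems.PrintX10bPinned.twoSidedLinkAnyClassNumberX10bPinnedOfPrint_holds
        hPT hHP)
      hHP Summit.BirchSwinnertonDyer.BirchSwinnertonDyer.Cruxes.AnalyticMuZeroX10b.TheoremB.AnalyticMuZeroX10b_of hP)

/-- **Partition leaf `X10.BSDpOnClassX10b` ⟸ seven cite-only print binders ⊕ the μ-inequality** (through the LIGHT
assembly `AssemblyLightTwinsX10b`, proved p622251, fed with the light A₃ containment from the closer, the B₃ door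
(p613989) and analytic `μ = 0` on class X10b (`AnalyticMuZeroX10b_of`)).
[cite: JetchevSkinnerWan2017, Thm. 3.3.1] [cite: YanZhu2024MainConjNonCM, Thm. 5.7 (1), Thm. 5.9]
[cite: CastellaGrossiLeeSkinner2022, Conj. 1 (the μ-part)] -/
theorem bsdpOnClassX10b_of_muStabilized_of_printBinders (hμ : PrintX10bSharpMuStabilized.Stmt.muInequalityStabilized)
    (hMZ : MastellaZermanHowardDivisibility) (hNV : CGLSHeegnerClassNonvanishing)
    (hCGS : CGSHowardDivisibilityPLocalized) (hTw : AnticyclotomicTowerSharp) (hPT : PinnedTransferPrintFacts)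
    (hHP : HeegnerPrintFactsX10b) (hP : PrintFactsX10b) :
    Summit.BirchSwinnertonDyer.Rank1Residual.X10.BSDpOnClassX10b :=
  Summit.BirchSwinnertonDyer.BirchSwinnertonDyer.Theorems.PrintX10bAssemblyLightTwinsX10b.assemblyLightTwinsX10b_proof
    (PrintX10bSharpMuStabilized.howardContainmentLightFrameX10bPinned_of_print_of_muStabilized hμ hMZ hNV hCGS hTw)
    (Summit.BirchSwinnertonDyer.BirchSwinnertonDyer.Theorems.PrintX10bPinned.twoSidedLinkAnyClassNumberX10bPinnedOfPrint_holds
      hPT hHP)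
    hHP Summit.BirchSwinnertonDyer.BirchSwinnertonDyer.Cruxes.AnalyticMuZeroX10b.TheoremB.AnalyticMuZeroX10b_of hP

/-- **Row-10 corner `WAllCornerX10b` ⟸ seven cite-only print binders ⊕ the cell's ONE shared μ-item letter**
`HeegnerMuPartStabilized.MuPartStabilizedOfPrint` (p625984; MZ26 Thm 3.15's printed hypotheses with `p ∣ h_K`, stabilised
class, length at `(p)`) — through `PrintX10bSplitStabilized.howardContainmentLightFrameX10bPinnedOfPrint_of_common` (p628126).
[cite: MastellaZerman2026, Thm. 3.15 (iii), Cor. 4.6] [cite: CastellaGrossiLeeSkinner2022, Conj. 1 (the μ-part)] -/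
theorem wallCornerX10b_of_common_of_printBinders (hμ : MuPartStabilizedOfPrint)
    (hMZ : MastellaZermanHowardDivisibility) (hNV : CGLSHeegnerClassNonvanishing)
    (hCGS : CGSHowardDivisibilityPLocalized) (hTw : AnticyclotomicTowerSharp) (hPT : PinnedTransferPrintFacts)
    (hHP : HeegnerPrintFactsX10b) (hP : PrintFactsX10b) :
    Summit.BirchSwinnertonDyer.WAllCornerX10b :=
  -- buildfix (bf3-g30, class (i) drift): route PrintX10b's `closes` was re-keyed; the pre-edit body
  -- (`wallCornerX10b_of_bsdpOnClassX10b` ∘ light assembly, closed doors BY NAME) is inlined; statement unchanged.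
  Summit.BirchSwinnertonDyer.Rank1Residual.WAll.wallCornerX10b_of_bsdpOnClassX10b
    (Summit.BirchSwinnertonDyer.BirchSwinnertonDyer.Theorems.PrintX10bAssemblyLightTwinsX10b.assemblyLightTwinsX10b_proof
      (PrintX10bSplitStabilized.howardContainmentLightFrameX10bPinned_of_print_of_common hμ hMZ hNV hCGS hTw)
      (Summit.BirchSwinnertonDyer.BirchSwinnertonDyer.Theorems.PrintX10bPinned.twoSidedLinkAnyClassNumberX10bPinnedOfPrint_holds
        hPT hHP)
      hHP Summit.BirchSwinnertonDyer.BirchSwinnertonDyer.Cruxes.AnalyticMuZeroX10b.TheoremB.AnalyticMuZeroX10b_of hP)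

/-- **Partition leaf `X10.BSDpOnClassX10b` ⟸ seven cite-only print binders ⊕ the shared μ-item letter** (the board's reading of
row 10: «A-door closed by name; open = {the anticyclotomic algebraic μ-part at 3 ∣ h_K}»).
[cite: MastellaZerman2026, Thm. 3.15 (iii)] [cite: CastellaGrossiLeeSkinner2022, Conj. 1 (the μ-part)]
[cite: JetchevSkinnerWan2017, Thm. 3.3.1] -/
theorem bsdpOnClassX10b_of_common_of_printBinders (hμ : MuPartStabilizedOfPrint)
    (hMZ : MastellaZermanHowardDivisibility) (hNV : CGLSHeegnerClassNonvanishing)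
    (hCGS : CGSHowardDivisibilityPLocalized) (hTw : AnticyclotomicTowerSharp) (hPT : PinnedTransferPrintFacts)
    (hHP : HeegnerPrintFactsX10b) (hP : PrintFactsX10b) :
    Summit.BirchSwinnertonDyer.Rank1Residual.X10.BSDpOnClassX10b :=
  Summit.BirchSwinnertonDyer.BirchSwinnertonDyer.Theorems.PrintX10bAssemblyLightTwinsX10b.assemblyLightTwinsX10b_proof
    (PrintX10bSplitStabilized.howardContainmentLightFrameX10bPinned_of_print_of_common hμ hMZ hNV hCGS hTw)
    (Summit.BirchSwinnertonDyer.BirchSwinnertonDyer.Theorems.PrintX10bPinned.twoSidedLinkAnyClassNumberX10bPinnedOfPrint_holds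
      hPT hHP)
    hHP Summit.BirchSwinnertonDyer.BirchSwinnertonDyer.Cruxes.AnalyticMuZeroX10b.TheoremB.AnalyticMuZeroX10b_of hP

end Summit.BirchSwinnertonDyer.BirchSwinnertonDyer.Theorems.PrintX10bResidualCertificate

end
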